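import Summits.BirchSwinnertonDyer.Rank1Residual.P2.CongruentNumberRankZeroTYZKernelDescent
import Summits.BirchSwinnertonDyer.Rank1Residual.P2.CongruentNumberPairsAtTwoDoorAAtlasThree
import Literature.NumberTheory.EllipticCurves.TianYuanZhang2017.UPlusOfRankLeOne
import Literature.NumberTheory.EllipticCurves.CongruentNumberSelmerEightShaTwo
import Literature.NumberTheory.EllipticCurves.CongruentNumberOddMonskySelmerExact
import Literature.NumberTheory.QuadraticFields.RedeiReichardtFourRank
import HarnessLib

/-!
# Cell `bsd-print-cf2` (leaf CornerF @ `p = 2`, row B14), prover p2 — the `2`-DESCENT-MATRIX ROAD WITHOUT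
# GROSS–ZAGIER–KOLYVAGIN: `BSD(E_n, 2)` on the genus doors of `B14 ∩ {j = 1728}` from ONE displayed source
# (Tian–Yuan–Zhang 2017 §3, `tyz_genusPointData`) — the rank bound of the Euler system replaced by `2`-descent

HONEST FRAMING (cell `bsd-print-cf2`, HOME `run/shared/lean/pub/bsd-print-cf2/`; D-0131 (2) PRINT TIER;
PARTITION currency, D-0054 (2)). The leaf is `CornerF W 2 = HasCM ∧ analyticRank = 1` at `p = 2` (row B14 /
O12; `0` census cells, OPEN AS A CLASS); this file is about its congruent-number members `E_n : y² = x³ − n²x`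
and asserts NO arithmetic fact: every theorem is a kernel theorem MODULO the single named journal fact
`hTYZ : TianYuanZhang2017.tyz_genusPointData` (Asian J. Math. 21 (2017) §3: Prop. 3.4, Thm. 3.5 main clause
and bullets, Lemmas 3.18/3.21, displayed sentence by sentence). Files p533042 / p533057 / p533567 of this series
re-keyed the doors to `{hTYZ, hGZK}`; here the binder `hGZK : rank_eq_analyticRank_of_analyticRank_le_one`
(Gross–Zagier 1986 + Kolyvagin 1990: `rank = r_an` and `Ш` finite for `r_an ≤ 1`) is STRUCK as well. It entered
at three places, each now supplied by `2`-descent in the kernel or by the displayed §3 sentences themselves: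
(1) inside U⁺ (`W2.uPlus_genusField_of`) only as `rank E_n(ℚ) ≤ 1` — now the tree's
`W2.uPlus_genusField_of_mordellWeilRank_le_one`, the bound coming from `#Sel⁽²⁾(E_n/ℚ) = 8` (Monsky's matrices
with equality, Silverman X.4.2); (2) as `rank E_n(ℚ) ≥ 1` when `ord_{s=1} L(E_n, s) = 1` — now
`W2.even_genusSums_of_mordellWeilRank_eq_zero`: by Thm. 3.5's main clause with the generator `α_n = 0` of a
finite `A_n(ℚ)`, rank `0` makes the genus point torsion and hence (proof of Thm. 3.5 (2)) the genus sums EVEN —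
so an ODD genus sum forces rank `≥ 1`; (3) as the finiteness of `Ш` in Miller's `BSD(E, 2)` — NOT needed:
`BSD(E, p)` only involves `Ш[p^∞]`, and `Ш(E_n)[2^∞] = 0` follows from `#Sel₂ = 8` and rank `1`
(`bsdp_iff_valuation_of_leadingLCoeff_of_primaryComponent_eq_bot`, p533376).

WHAT IT PROVES (displayed set `{hTYZ}` — ONE paper — and nothing else):
* §1 the door for classes `5`, `7` (`rankOne_sha_bsdp_two_congruentNumberCurve_of_selmerEight_noGZK`): square-free
  `n ≡ 5, 7 (mod 8)`, `#Sel⁽²⁾(E_n/ℚ) = 8` (KERNEL-decidable: Monsky), `Σ₁(n)` odd or `Σ₂′(n)` odd (Rédei-decidable)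
  ⟹ `ord_{s=1} L(E_n, s) = 1`, `rank E_n(ℚ) = 1`, `Ш(E_n)[2^∞] = 0`, `BSD(E_n, 2)`; the class-`6` door (`n ≡ 6`,
  `#Sel₂ = 8`, `Σ₂′(n)` odd); the Monsky-table forms;
* §2 the `ω(n) = 3` configuration atlas (`doorACfg`; class `7` from `s(n) = 1` ALONE) without GZK.
The uniform families (every prime `q ≡ 7 (8)`, `p₃q₅`, `p₃q₇`, `2·p₅·q` with `(p/q) = +1`, Tian's class-`6`/`7`
families) follow in the sibling file `CongruentNumberGenusFamiliesNoGZK.lean`. "Beyond-print theorem": NO new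
STATEMENT (the `2`-part of BSD on these families is asserted in print, Tian ICM 2022 Thm 8); the DERIVATION displays
one refereed source and uses neither Kolyvagin's Euler system nor the finiteness of `Ш` — the rank bound is Monsky's
`2`-descent (as in Monsky, Math. Z. 204 (1990), Remark (2): «the rank is bounded by `dim S̄ = 1`»), kernel-proved.
READING DISCLOSURE (for the referee). Print states Thm. 3.5's main clause «`𝒫(n) = 2^{−1−ρ}𝓛(n)α_n`, `α_n`
any generator of the free part of `A(K_n)⁻` if `𝓛(n) ≠ 0`» under the TACIT presupposition `rank = 1` (which
print obtains from Gross–Zagier–Kolyvagin); the display `GenusPointData.thm35Main` quantifies over generators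
WITHOUT that presupposition (lit-1's documented weakening), and in rank `0` the generator `α_n = 0` qualifies —
step (2) uses the displayed sentence in exactly this degenerate case. The consequence drawn, «rank `0` ⟹ genus
sums even», is TRUE in print's world as well (rank `0` and root number `−1` give `r_an ≥ 3` by GZK, so
`𝓛(n) = 0` and `P(n)` is torsion by Thm. 3.5, whence the sums are even by Thm. 3.5 (2)): no printed result is
strengthened; what is saved is the DISPLAY of GZK as a binder, not an appeal to its truth somewhere in print.
Nothing booked; no mark moved; `0` census cells. Unit `bsd-print-cf2-p2` g0; NEW file.

References: [TianYuanZhang2017] §3 (Prop 3.4, Thm 3.5, Lemmas 3.18, 3.21), Thm 1.2; [Monsky1990MockHeegner]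
Remark (2) p. 67; [HeathBrown1994SelmerCongruentII] Appendix (Monsky); [SilvermanAEC2009] Thm X.4.2;
[Miller2011LMS] Def 1.1; [Tian2023CongruentICM] Thm 8.
-/

noncomputable section

open scoped Classical

open Matrix Finset WeierstrassCurve NumberField Literature.NumberTheory.EllipticCurves
  Literature.NumberTheory.EllipticCurves.Rank1Residual
  Literature.NumberTheory.EllipticCurves.Rank1Residual.Typed
  Literature.NumberTheory.EllipticCurves.HeathBrown1994
  Literature.NumberTheory.EllipticCurves.HeathBrown1994.Families
  Literature.NumberTheory.EllipticCurves.TianYuanZhang2017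
  Literature.NumberTheory.EllipticCurves.Tian2014
  Literature.NumberTheory.EllipticCurves.SelmerEightShaTwo
  Literature.NumberTheory.QuadraticFields.RedeiReichardt

set_option autoImplicit false

namespace Summit.BirchSwinnertonDyer.Rank1Residual.P2

/-! ## §1 The doors without Gross–Zagier–Kolyvagin -/

section Doors

/-- **THE ODD DOOR WITHOUT GZK (classes `5`, `7`).** For square-free `n ≡ 5, 7 (mod 8)` with
`#Sel⁽²⁾(E_n/ℚ) = 8` and `Σ₁(n)` odd or `Σ₂′(n)` odd (over `GenusField`): `ord_{s=1} L(E_n, s) = 1`,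
`rank E_n(ℚ) = 1`, `Ш(E_n)[2^∞] = 0` and `BSD(E_n, 2)` — modulo `hTYZ` ALONE. Route: `#Sel₂ = 8` ⟹ `rank ≤ 1`
(Silverman X.4.2) ⟹ U⁺ (TYZ §3, kernel W2 run on the rank bound) ⟹ `𝓛(n)` odd ⟹ `r_an = 1`; rank `0` would make
the genus sums even (TYZ §3 with `α_n = 0`) ⟹ `rank = 1` ⟹ `Ш[2] = 0`; `L′(E_n,1) = 2^{2k−2−a}·𝓛²·Ω·Reg`,
`#E_n(ℚ)_tor = 4`, `∏c_ℓ = 2^{2k+2−a}` (kernel) ⟹ `BSD(E_n, 2)` by Miller's definition (only `Ш[2^∞]` enters).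
[cite: TianYuanZhang2017, Thm. 3.5 and its proof; §1 (1.1)] [cite: SilvermanAEC2009, Thm. X.4.2]
[cite: Monsky1990MockHeegner, Remark (2) (p. 67)] [cite: Miller2011LMS, Def. 1.1 (arXiv:1010.2431 p. 3)] -/
theorem rankOne_sha_bsdp_two_congruentNumberCurve_of_selmerEight_noGZK (hTYZ : tyz_genusPointData)
    {n : ℕ} (hsq : Squarefree n) (h8 : n % 8 = 5 ∨ n % 8 = 7)
    (hsel : Nat.card ((congruentNumberCurve n).selmerGroup 2) = 8)
    (hgen : Odd (genusSum₁ n fun d => genusClassNumber (GenusField d)) ∨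
      Odd (genusSum₂' n fun d => genusClassNumber (GenusField d))) :
    haveI := isElliptic_congruentNumberCurve hsq.ne_zero
    (congruentNumberCurve n).analyticRank = 1 ∧ (congruentNumberCurve n).mordellWeilRank = 1 ∧
      AddCommGroup.primaryComponent (congruentNumberCurve n).sha 2 = ⊥ ∧
      BSDp (congruentNumberCurve n) 2 := by
  have hn0 : n ≠ 0 := hsq.ne_zero
  haveI := isElliptic_congruentNumberCurve hn0
  haveI : Fact (Nat.Prime 2) := ⟨Nat.prime_two⟩
  have h8' : n % 8 = 5 ∨ n % 8 = 6 ∨ n % 8 = 7 := by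
    rcases h8 with h | h
    · exact Or.inl h
    · exact Or.inr (Or.inr h)
  -- `2`-descent: rank `≤ 1`, and the rank/`Ш[2]` dichotomy
  have hcases := mordellWeilRank_card_sha_two_cases_of_card_selmerGroup_two_eq_eight hn0 hsel
  have hr : (congruentNumberCurve n).mordellWeilRank ≤ 1 := by
    rcases hcases with ⟨h, -⟩ | ⟨h, -⟩ <;> omega
  -- U⁺ on the rank bound: `𝓛(n)` odd, `r_an = 1`
  obtain ⟨L, hL, h57, -⟩ := W2.uPlus_genusField_of_mordellWeilRank_le_one hTYZ hsq h8' hr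
  have hLodd : Odd L := by
    refine Int.not_even_iff_odd.mp fun hLe => ?_
    obtain ⟨h1, h2⟩ := h57 h8 (even_iff_two_dvd.mp hLe)
    rcases hgen with hg | hg
    · exact (Nat.not_even_iff_odd.mpr hg) h1
    · exact (Nat.not_even_iff_odd.mpr hg) h2
  have hL0 : L ≠ 0 := fun h => by simp [h] at hLodd
  have hr1 : (congruentNumberCurve n).analyticRank = 1 :=
    analyticRank_congruentNumberCurve_eq_one_of_isScriptL hsq h8' hL hL0
  -- rank `0` is impossible: it would make the genus sums even
  have hrank : (congruentNumberCurve n).mordellWeilRank = 1 := by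
    rcases hcases with ⟨h, -⟩ | ⟨h0, -⟩
    · exact h
    · exfalso
      obtain ⟨h1, h2⟩ := (W2.even_genusSums_of_mordellWeilRank_eq_zero hTYZ hsq h8' h0).1 h8
      rcases hgen with hg | hg
      · exact (Nat.not_even_iff_odd.mpr hg) h1
      · exact (Nat.not_even_iff_odd.mpr hg) h2
  have hbot := primaryComponent_sha_two_eq_bot_of_card_selmerGroup_eq_eight hn0 hrank hsel
  refine ⟨hr1, hrank, hbot, ?_⟩
  -- the leading coefficient and Miller's `BSD(E, 2)` (only `Ш[2^∞]` enters)
  have hlead : (congruentNumberCurve n).leadingLCoeff =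
      (((2 : ℚ) ^ twoExponent n * (L : ℚ) ^ 2 : ℚ) : ℂ) *
        ((congruentNumberCurve n).realPeriodRat : ℂ) * ((congruentNumberCurve n).regulator : ℂ) := by
    rw [leadingLCoeff_congruentNumberCurve_eq_of_isScriptL (Nat.pos_of_ne_zero hn0) hr1 hL]
    push_cast; ring
  have hx0 : (2 : ℚ) ^ twoExponent n * (L : ℚ) ^ 2 ≠ 0 := by
    have hL0' : (L : ℚ) ≠ 0 := by exact_mod_cast hL0
    exact mul_ne_zero (zpow_ne_zero _ two_ne_zero) (pow_ne_zero _ hL0')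
  rw [bsdp_iff_valuation_of_leadingLCoeff_of_primaryComponent_eq_bot (congruentNumberCurve n) 2
    (hrank.trans hr1.symm) hx0 hlead hbot, padicValRat_two_zpow_mul_sq hLodd,
    tamagawaProduct_congruentNumberCurve_eq_two_pow hsq, torsionOrder_congruentNumberCurve hsq,
    padicValNat.prime_pow, show (4 : ℕ) = 2 ^ 2 by norm_num, padicValNat.prime_pow]
  unfold twoExponent oddPrimeFactorCount oddIndicator
  split_ifs <;> push_cast <;> omega

/-- **THE EVEN DOOR WITHOUT GZK (class `6`).** For square-free `n ≡ 6 (mod 8)` with `#Sel⁽²⁾(E_n/ℚ) = 8` and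
`Σ₂′(n)` odd: `ord_{s=1} L(E_n, s) = 1`, `rank E_n(ℚ) = 1`, `Ш(E_n)[2^∞] = 0`, `BSD(E_n, 2)` — modulo `hTYZ`
ALONE. [cite: TianYuanZhang2017, Thm. 3.5 and its proof; §1 (1.1)] [cite: SilvermanAEC2009, Thm. X.4.2]
[cite: Miller2011LMS, Def. 1.1 (arXiv:1010.2431 p. 3)] -/
theorem rankOne_sha_bsdp_two_congruentNumberCurve_of_selmerEight_six_noGZK (hTYZ : tyz_genusPointData)
    {n : ℕ} (hsq : Squarefree n) (h8 : n % 8 = 6)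
    (hsel : Nat.card ((congruentNumberCurve n).selmerGroup 2) = 8)
    (hgen : Odd (genusSum₂' n fun d => genusClassNumber (GenusField d))) :
    haveI := isElliptic_congruentNumberCurve hsq.ne_zero
    (congruentNumberCurve n).analyticRank = 1 ∧ (congruentNumberCurve n).mordellWeilRank = 1 ∧
      AddCommGroup.primaryComponent (congruentNumberCurve n).sha 2 = ⊥ ∧
      BSDp (congruentNumberCurve n) 2 := by
  have hn0 : n ≠ 0 := hsq.ne_zero
  haveI := isElliptic_congruentNumberCurve hn0
  haveI : Fact (Nat.Prime 2) := ⟨Nat.prime_two⟩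
  have h8' : n % 8 = 5 ∨ n % 8 = 6 ∨ n % 8 = 7 := Or.inr (Or.inl h8)
  have hcases := mordellWeilRank_card_sha_two_cases_of_card_selmerGroup_two_eq_eight hn0 hsel
  have hr : (congruentNumberCurve n).mordellWeilRank ≤ 1 := by
    rcases hcases with ⟨h, -⟩ | ⟨h, -⟩ <;> omega
  obtain ⟨L, hL, -, h6⟩ := W2.uPlus_genusField_of_mordellWeilRank_le_one hTYZ hsq h8' hr
  have hLodd : Odd L := by
    refine Int.not_even_iff_odd.mp fun hLe => ?_
    exact (Nat.not_even_iff_odd.mpr hgen) (h6 h8 (even_iff_two_dvd.mp hLe))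
  have hL0 : L ≠ 0 := fun h => by simp [h] at hLodd
  have hr1 : (congruentNumberCurve n).analyticRank = 1 :=
    analyticRank_congruentNumberCurve_eq_one_of_isScriptL hsq h8' hL hL0
  have hrank : (congruentNumberCurve n).mordellWeilRank = 1 := by
    rcases hcases with ⟨h, -⟩ | ⟨h0, -⟩
    · exact h
    · exfalso
      exact (Nat.not_even_iff_odd.mpr hgen)
        ((W2.even_genusSums_of_mordellWeilRank_eq_zero hTYZ hsq h8' h0).2 h8)
  have hbot := primaryComponent_sha_two_eq_bot_of_card_selmerGroup_eq_eight hn0 hrank hsel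
  refine ⟨hr1, hrank, hbot, ?_⟩
  have hlead : (congruentNumberCurve n).leadingLCoeff =
      (((2 : ℚ) ^ twoExponent n * (L : ℚ) ^ 2 : ℚ) : ℂ) *
        ((congruentNumberCurve n).realPeriodRat : ℂ) * ((congruentNumberCurve n).regulator : ℂ) := by
    rw [leadingLCoeff_congruentNumberCurve_eq_of_isScriptL (Nat.pos_of_ne_zero hn0) hr1 hL]
    push_cast; ring
  have hx0 : (2 : ℚ) ^ twoExponent n * (L : ℚ) ^ 2 ≠ 0 := by
    have hL0' : (L : ℚ) ≠ 0 := by exact_mod_cast hL0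
    exact mul_ne_zero (zpow_ne_zero _ two_ne_zero) (pow_ne_zero _ hL0')
  rw [bsdp_iff_valuation_of_leadingLCoeff_of_primaryComponent_eq_bot (congruentNumberCurve n) 2
    (hrank.trans hr1.symm) hx0 hlead hbot, padicValRat_two_zpow_mul_sq hLodd,
    tamagawaProduct_congruentNumberCurve_eq_two_pow hsq, torsionOrder_congruentNumberCurve hsq,
    padicValNat.prime_pow, show (4 : ℕ) = 2 ^ 2 by norm_num, padicValNat.prime_pow]
  unfold twoExponent oddPrimeFactorCount oddIndicator
  split_ifs <;> push_cast <;> omega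

variable {k : ℕ} (p : Fin k → ℕ)

/-- **THE ODD DOOR WITHOUT GZK, MONSKY-KERNEL FORM**: `n = p₁⋯p_k` (distinct odd primes), `n ≡ 5, 7 (mod 8)`,
a `2`-element kernel of Monsky's matrix (`s(n) = 1`), a genus sum odd ⟹ `ord = 1`, rank `1`, `Ш[2^∞] = 0`,
`BSD(E_n, 2)` — modulo `hTYZ` alone. [cite: TianYuanZhang2017, Thm. 3.5 and its proof; §1 (1.1)]
[cite: HeathBrown1994SelmerCongruentII, Appendix (Monsky), typescript p. 39 L10–L33] [cite: Miller2011LMS, Def. 1.1] -/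
theorem rankOne_sha_bsdp_two_congruentNumberCurve_of_card_ker_noGZK (hTYZ : tyz_genusPointData)
    (hp : ∀ i, (p i).Prime) (hodd : ∀ i, Odd (p i)) (hinj : Function.Injective p)
    {n : ℕ} (hn : ∏ i, p i = n) (h8 : n % 8 = 5 ∨ n % 8 = 7)
    (hker : Fintype.card {v : Fin k ⊕ Fin k → ZMod 2 // monskyMatrixOdd p *ᵥ v = 0} = 2)
    (hgen : Odd (genusSum₁ n fun d => genusClassNumber (GenusField d)) ∨
      Odd (genusSum₂' n fun d => genusClassNumber (GenusField d))) :
    haveI := isElliptic_congruentNumberCurve (hn ▸ (squarefree_prod_of_injective p hp hinj).ne_zero)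
    (congruentNumberCurve n).analyticRank = 1 ∧ (congruentNumberCurve n).mordellWeilRank = 1 ∧
      AddCommGroup.primaryComponent (congruentNumberCurve n).sha 2 = ⊥ ∧
      BSDp (congruentNumberCurve n) 2 := by
  have hsq : Squarefree n := hn ▸ squarefree_prod_of_injective p hp hinj
  have hs : monskySelmerRankOdd p = 1 := (monskySelmerRankOdd_eq_one_iff_card_ker p).mpr hker
  have hsel : Nat.card ((congruentNumberCurve n).selmerGroup 2) = 8 := by
    subst hn
    rw [monsky_card_selmerGroup_two_odd_holds k p hp hodd hinj, hs]
    norm_num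
  exact rankOne_sha_bsdp_two_congruentNumberCurve_of_selmerEight_noGZK hTYZ hsq h8 hsel hgen

/-- **THE ODD DOOR WITHOUT GZK, TABLE-ROUTE FORM** (the signature of `…_of_genusPointData` minus `hGZK` and
`hM`): the Legendre data supplied as closed tables `L`, `d2`, `dm2` (so that the kernel count is a `decide` per
member), `n ≡ 5, 7 (mod 8)`, a genus sum odd ⟹ `ord = 1`, rank `1`, `Ш[2^∞] = 0`, `BSD(E_n, 2)` — modulo `hTYZ`
alone. [cite: TianYuanZhang2017, Thm. 3.5 and its proof; §1 (1.1)]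
[cite: HeathBrown1994SelmerCongruentII, Appendix (Monsky), typescript p. 39 L10–L33] [cite: Miller2011LMS, Def. 1.1] -/
theorem rankOne_sha_bsdp_two_congruentNumberCurve_of_table_noGZK (hTYZ : tyz_genusPointData)
    (hp : ∀ i, (p i).Prime) (hodd : ∀ i, Odd (p i)) (hinj : Function.Injective p)
    {n : ℕ} (hn : ∏ i, p i = n) (h8 : n % 8 = 5 ∨ n % 8 = 7)
    (L : Fin k → Fin k → ZMod 2) (d2 dm2 : Fin k → ZMod 2)
    (hL : ∀ i j, addLegendreSym (p j) (p i) = L i j) (h2 : ∀ i, addLegendreSym 2 (p i) = d2 i)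
    (hm2 : ∀ i, addLegendreSym (-2) (p i) = dm2 i)
    (hker : Fintype.card {v : Fin k ⊕ Fin k → ZMod 2 // Matrix.fromBlocks
        (Matrix.of (fun i j => if i = j then ∑ l ∈ Finset.univ.erase i, L i l else L i j) +
          Matrix.diagonal d2) (Matrix.diagonal d2) (Matrix.diagonal d2)
        (Matrix.of (fun i j => if i = j then ∑ l ∈ Finset.univ.erase i, L i l else L i j) +
          Matrix.diagonal dm2) *ᵥ v = 0} = 2)
    (hgen : Odd (genusSum₁ n fun d => genusClassNumber (GenusField d)) ∨
      Odd (genusSum₂' n fun d => genusClassNumber (GenusField d))) :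
    haveI := isElliptic_congruentNumberCurve (hn ▸ (squarefree_prod_of_injective p hp hinj).ne_zero)
    (congruentNumberCurve n).analyticRank = 1 ∧ (congruentNumberCurve n).mordellWeilRank = 1 ∧
      AddCommGroup.primaryComponent (congruentNumberCurve n).sha 2 = ⊥ ∧
      BSDp (congruentNumberCurve n) 2 := by
  have hsq : Squarefree n := hn ▸ squarefree_prod_of_injective p hp hinj
  have hs : monskySelmerRankOdd p = 1 :=
    monskySelmerRankOdd_eq_of_table p L d2 dm2 hL h2 hm2 (s := 1) (by rw [hker, pow_one])
  have hsel : Nat.card ((congruentNumberCurve n).selmerGroup 2) = 8 := by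
    subst hn
    rw [monsky_card_selmerGroup_two_odd_holds k p hp hodd hinj, hs]
    norm_num
  exact rankOne_sha_bsdp_two_congruentNumberCurve_of_selmerEight_noGZK hTYZ hsq h8 hsel hgen

end Doors

/-! ## §2 The `ω(n) = 3` configuration atlas without GZK -/

section Atlas

variable (p : Fin 3 → ℕ)

/-- **DOOR A IN CONFIGURATION CURRENCY WITHOUT GZK (`ω(n) = 3`).** For distinct primes `p₀, p₁, p₂` whose
Legendre configuration satisfies `doorACfg`: `ord_{s=1} L(E_n, s) = 1`, rank `1`, `Ш(E_n)[2^∞] = 0`,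
`BSD(E_n, 2)` (`n = p₀p₁p₂`) — modulo `hTYZ` ALONE (the configuration is read into the Monsky kernel count and the
genus parities by the tree's transfer lemmas; Rédei–Reichardt and Monsky's formula are tree theorems).
[cite: TianYuanZhang2017, Thm. 3.5 and its proof; §1 (1.1)] [cite: HeathBrown1994SelmerCongruentII, Appendix (Monsky), typescript p. 39 L10–L33]
[cite: IrelandRosen1990, Ch. 5 §2 Thm. 1] [cite: Miller2011LMS, Def. 1.1 (arXiv:1010.2431 p. 3)] -/
theorem rankOne_sha_bsdp_two_congruentNumberCurve_of_doorACfg_noGZK (hTYZ : tyz_genusPointData)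
    (hp : ∀ i, (p i).Prime) (hinj : Function.Injective p) {n : ℕ} (hn : ∏ i, p i = n)
    (hcfg : doorACfg (fun i => p i % 8) (fun a b => kroneckerBit (p b) (p a)) = true) :
    haveI := isElliptic_congruentNumberCurve (hn ▸ (squarefree_prod_of_injective p hp hinj).ne_zero)
    (congruentNumberCurve n).analyticRank = 1 ∧ (congruentNumberCurve n).mordellWeilRank = 1 ∧
      AddCommGroup.primaryComponent (congruentNumberCurve n).sha 2 = ⊥ ∧
      BSDp (congruentNumberCurve n) 2 := by
  have hn3 : n = p 0 * p 1 * p 2 := by rw [← hn, Fin.prod_univ_three]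
  obtain ⟨h8r, hker, hgen⟩ := (doorACfg_eq_true_iff _ _).mp hcfg
  have h8 : n % 8 = 5 ∨ n % 8 = 7 := by rwa [mod_eight_mul_three, ← hn3] at h8r
  have hp2 : ∀ i, p i ≠ 2 := by
    intro i hi
    have hdvd : p i ∣ n := hn ▸ Finset.dvd_prod_of_mem p (Finset.mem_univ i)
    rw [hi] at hdvd
    rcases h8 with h | h <;> omega
  have hodd : ∀ i, Odd (p i) := fun i => (hp i).odd_of_ne_two (hp2 i)
  have h8' : (p 0 * p 1 * p 2) % 8 = 5 ∨ (p 0 * p 1 * p 2) % 8 = 6 ∨ (p 0 * p 1 * p 2) % 8 = 7 := by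
    rcases h8 with h | h
    · exact Or.inl (hn3 ▸ h)
    · exact Or.inr (Or.inr (hn3 ▸ h))
  have hgen' : Odd (genusSum₁ n fun d => genusClassNumber (GenusField d)) ∨
      Odd (genusSum₂' n fun d => genusClassNumber (GenusField d)) := by
    rw [sigma1Cfg_eq_natCast_genusSum₁ p redeiReichardt_fourTwoCard_classGroup_holds hp hp2 hinj,
      sigma2Cfg_add_gBitSub_eq_natCast_genusSum₂' p redeiReichardt_fourTwoCard_classGroup_holds hp hp2 hinj
        h8', ← hn3, ZMod.natCast_eq_one_iff_odd, ZMod.natCast_eq_one_iff_odd] at hgen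
    exact hgen
  have hker' : Fintype.card {v : Fin 3 ⊕ Fin 3 → ZMod 2 // monskyMatrixOdd p *ᵥ v = 0} = 2 := by
    rw [card_ker_monskyMatrixOdd_eq_cfg p hp hp2 hinj]; exact hker
  exact rankOne_sha_bsdp_two_congruentNumberCurve_of_card_ker_noGZK p hTYZ hp hodd hinj hn h8 hker' hgen'

/-- **CLASS `7`, `ω(n) = 3`, WITHOUT GZK: `s(n) = 1` ALONE gives `BSD(E_n, 2)`** — for distinct primes with
`p₀p₁p₂ ≡ 7 (mod 8)` and a `2`-element kernel of Monsky's matrix: `r_an = 1`, rank `1`, `Ш[2^∞] = 0`,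
`BSD(E_n, 2)`, modulo `hTYZ` alone. [cite: TianYuanZhang2017, Thm. 3.5 and its proof; §1 (1.1)]
[cite: HeathBrown1994SelmerCongruentII, Appendix (Monsky), typescript p. 39 L10–L33] [cite: Miller2011LMS, Def. 1.1] -/
theorem rankOne_sha_bsdp_two_congruentNumberCurve_three_primes_seven_noGZK (hTYZ : tyz_genusPointData)
    (hp : ∀ i, (p i).Prime) (hinj : Function.Injective p) {n : ℕ} (hn : ∏ i, p i = n)
    (h7 : n % 8 = 7)
    (hker : Fintype.card {v : Fin 3 ⊕ Fin 3 → ZMod 2 // monskyMatrixOdd p *ᵥ v = 0} = 2) :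
    haveI := isElliptic_congruentNumberCurve (hn ▸ (squarefree_prod_of_injective p hp hinj).ne_zero)
    (congruentNumberCurve n).analyticRank = 1 ∧ (congruentNumberCurve n).mordellWeilRank = 1 ∧
      AddCommGroup.primaryComponent (congruentNumberCurve n).sha 2 = ⊥ ∧
      BSDp (congruentNumberCurve n) 2 := by
  have hn3 : n = p 0 * p 1 * p 2 := by rw [← hn, Fin.prod_univ_three]
  have hp2 := ne_two_of_prod_eq p hn h7
  obtain ⟨r₀, r₁, r₂, ⟨e₀, e₁, e₂⟩, hRfun, hBfun⟩ := cfg_three_eq_betaOf p hp hp2 hinj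
  have h7r : (r₀.val * r₁.val * r₂.val) % 8 = 7 := by
    rw [e₀, e₁, e₂, mod_eight_mul_three, ← hn3, h7]
  have hkerC := hker
  rw [card_ker_monskyMatrixOdd_eq_cfg p hp hp2 hinj, hRfun, hBfun] at hkerC
  have hsig := sigmaCfg_of_card_ker_seven r₀ r₁ r₂ _ _ _ h7r hkerC
  have hgood : doorACfg (fun i => p i % 8) (fun a b => kroneckerBit (p b) (p a)) = true := by
    rw [hRfun, hBfun, doorACfg_eq_true_iff]
    exact ⟨Or.inr h7r, hkerC, hsig⟩
  exact rankOne_sha_bsdp_two_congruentNumberCurve_of_doorACfg_noGZK p hTYZ hp hinj hn hgood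

/-- **`BSD(E_n, 2)` for EVERY `n = p₀p₁p₂ ≡ 7 (mod 8)` with `s(n) = 1`, WITHOUT GZK** (`∀`-form), modulo `hTYZ`
alone. [cite: TianYuanZhang2017, Thm. 3.5 and its proof; §1 (1.1)]
[cite: HeathBrown1994SelmerCongruentII, Appendix (Monsky), typescript p. 39 L33] [cite: Miller2011LMS, Def. 1.1] -/
theorem forall_bsdp_two_congruentNumberCurve_three_primes_seven_noGZK (hTYZ : tyz_genusPointData) :
    ∀ p : Fin 3 → ℕ, (∀ i, (p i).Prime) → Function.Injective p → (∏ i, p i) % 8 = 7 →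
      monskySelmerRankOdd p = 1 → BSDp (congruentNumberCurve (∏ i, p i)) 2 :=
  fun p hp hinj h7 hs =>
    (rankOne_sha_bsdp_two_congruentNumberCurve_three_primes_seven_noGZK p hTYZ hp hinj rfl h7
      ((monskySelmerRankOdd_eq_one_iff_card_ker p).mp hs)).2.2.2

/-- **EVERY `ω = 3` DOOR-A FAMILY AS A ONE-LINER WITHOUT GZK (upper-bits form)**: residues `r`, symbol bits `s`
with `doorACfg r (betaOf r s) = true` (`by decide`) ⟹ for ALL distinct primes realising the configuration,
`ord_{s=1} L(E_{p₀p₁p₂}, s) = 1` and `BSD(E_{p₀p₁p₂}, 2)`, modulo `hTYZ` alone.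
[cite: TianYuanZhang2017, Thm. 3.5 and its proof; §1 (1.1)] [cite: IrelandRosen1990, Ch. 5 §2 Thm. 1]
[cite: Miller2011LMS, Def. 1.1 (arXiv:1010.2431 p. 3)] -/
theorem bsdp_two_congruentNumberCurve_three_primes_of_doorACfg_noGZK (hTYZ : tyz_genusPointData)
    (r₀ r₁ r₂ : Fin 8) (s₀ s₁ s₂ : ZMod 2)
    (hcfg : doorACfg ![r₀.val, r₁.val, r₂.val]
      (betaOf ![r₀.val, r₁.val, r₂.val] ![s₀, s₁, s₂]) = true)
    {p₀ p₁ p₂ : ℕ} (hp₀ : p₀.Prime) (hp₁ : p₁.Prime) (hp₂ : p₂.Prime)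
    (h01 : p₀ ≠ p₁) (h02 : p₀ ≠ p₂) (h12 : p₁ ≠ p₂)
    (hr₀ : p₀ % 8 = r₀.val) (hr₁ : p₁ % 8 = r₁.val) (hr₂ : p₂ % 8 = r₂.val)
    (hs₀ : kroneckerBit p₁ p₀ = s₀) (hs₁ : kroneckerBit p₂ p₀ = s₁) (hs₂ : kroneckerBit p₂ p₁ = s₂) :
    haveI := isElliptic_congruentNumberCurve
      (Nat.mul_ne_zero (Nat.mul_ne_zero hp₀.ne_zero hp₁.ne_zero) hp₂.ne_zero)
    (congruentNumberCurve (p₀ * p₁ * p₂)).analyticRank = 1 ∧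
      BSDp (congruentNumberCurve (p₀ * p₁ * p₂)) 2 := by
  set p : Fin 3 → ℕ := ![p₀, p₁, p₂] with hpdef
  have hp : ∀ i, (p i).Prime := by intro i; fin_cases i <;> assumption
  have hinj : Function.Injective p := by
    intro i j h
    fin_cases i <;> fin_cases j <;> simp_all [p]
  have hn : ∏ i, p i = p₀ * p₁ * p₂ := by rw [Fin.prod_univ_three]; rfl
  -- the residues are odd (the guard of `doorACfg`), hence no prime is `2`
  have hg := ((doorACfg_eq_true_iff _ _).mp hcfg).1
  simp only [Matrix.cons_val_zero, Matrix.cons_val_one, Matrix.head_cons, Matrix.cons_val_two,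
    Matrix.tail_cons] at hg
  have hoddr : r₀.val % 2 = 1 ∧ r₁.val % 2 = 1 ∧ r₂.val % 2 = 1 := by
    have h2 : (r₀.val * r₁.val * r₂.val) % 2 = 1 := by rcases hg with h | h <;> omega
    have h' := Nat.odd_iff.mpr h2
    rw [Nat.odd_mul, Nat.odd_mul] at h'
    exact ⟨Nat.odd_iff.mp h'.1.1, Nat.odd_iff.mp h'.1.2, Nat.odd_iff.mp h'.2⟩
  have hp2 : ∀ i, p i ≠ 2 := by
    intro i; fin_cases i
    · show p₀ ≠ 2; omega
    · show p₁ ≠ 2; omega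
    · show p₂ ≠ 2; omega
  obtain ⟨r₀', r₁', r₂', ⟨e₀, e₁, e₂⟩, hRfun, hBfun⟩ := cfg_three_eq_betaOf p hp hp2 hinj
  have er₀ : r₀' = r₀ := Fin.ext (by rw [e₀]; exact hr₀)
  have er₁ : r₁' = r₁ := Fin.ext (by rw [e₁]; exact hr₁)
  have er₂ : r₂' = r₂ := Fin.ext (by rw [e₂]; exact hr₂)
  have hcfg' : doorACfg (fun i => p i % 8) (fun a b => kroneckerBit (p b) (p a)) = true := by
    rw [hRfun, hBfun, er₀, er₁, er₂]
    simpa [p, hs₀, hs₁, hs₂] using hcfg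
  have h := rankOne_sha_bsdp_two_congruentNumberCurve_of_doorACfg_noGZK p hTYZ hp hinj hn hcfg'
  exact ⟨h.1, h.2.2.2⟩

end Atlas

end Summit.BirchSwinnertonDyer.Rank1Residual.P2

end
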